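import Summits.HodgeConjecture.HodgeConjecture.Theorems.MarkmanPartnerTransportPicardThreeK3SquaresRealMultiplicationType

/-!
# Route MarkmanPartnerTransport · crux `PicardThreeK3Squares` (stmt-HodgeConjecture-19652) —
# «RM-EXACT-K3»: the real-multiplication third is EXACTLY van Geemen–Schütt's `IsRealMultiplicationK3`, and the
# table of the real-multiplication TYPES `(ρ, d, m)`

Sequel to `…RealMultiplicationType` («RM-GEN-K3»: a non-CM, non-scalar projective K3 surface is an RM K3 surface
`IsRealMultiplicationK3 S ρ(S) P` of a definite type). Here the CONVERSE and the bookkeeping: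

* `exists_transc_ne_zero` — a projective K3 surface has a non-zero transcendental class (the `(2,0)`-class of a
  marking is cup-orthogonal to `N¹(S)`);
* `not_scalar_of_isRealMultiplicationK3` — **an RM K3 surface `IsRealMultiplicationK3 S ρ P` with `P` irreducible of
  degree `≥ 2` is NOT scalar** (Bézout: `u·P + v·(X − a) = 1`, and `P(t) = 0 = t − a` on `T(S)` would kill `T(S) ∋ σ ≠ 0`);
* `not_hasComplexMultiplication_and_not_scalar_iff` — **«RM-EXACT-K3»**: `¬ CM ∧ ¬ Scalar ⟺ ∃ P m, Irreducible P ∧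
  2 ≤ deg P ∧ 3 ≤ m ∧ deg P · m + ρ(S) = 22 ∧ IsRealMultiplicationK3 S ρ(S) P` — the K3-side twin of
  `PartnerLattice.not_spannedByIsometries_iff_exists_rmGenerator`; so the lossless split
  `picardThreeK3Squares_of_isRealMultiplicationK3` loses nothing in either direction;
* `mem_rmTypes_of_three_le` — the FIFTEEN real-multiplication types with `ρ ≥ 3`:
  `(16,2,3) (14,2,4) (13,3,3) (12,2,5) (10,2,6) (10,3,4) (10,4,3) (8,2,7) (7,3,5) (7,5,3) (6,2,8) (6,4,4) (4,2,9) (4,3,6) (4,6,3)`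
  (and `mem_rmTypes`: the twenty types with `ρ ≥ 1`); `exists_isRealMultiplicationK3_cubic_of_rank_thirteen` —
  the cell's «RungRank13» BY NAME: a non-CM, non-scalar K3 surface with `ρ(S) = 13` has real multiplication by a
  totally real CUBIC field with `dim_E T(S) = 3` (type `(13,3,3)`, compact Shimura-curve strata).

No definition, no sorry, no named fact beyond the displayed `Huybrechts_K3_marking_exists`; nothing here proves the crux
or any instance of HC. Prover seat hodge-nonav-19652-p1 (gen 19), `--supports stmt-HodgeConjecture-19652`.

References: B. van Geemen, Michigan Math. J. 56 (2008) Lemma 3.2; B. van Geemen, M. Schütt, Forum Math. Sigma 13 (2025)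
e2, §2.1, §2.4, Table §3.4; Yu. G. Zarhin, J. reine angew. Math. 341 (1983) Thm. 1.5.1; D. Huybrechts, *Lectures on
K3 Surfaces*, Ch. 3 Lemma 3.3.1.
-/

set_option linter.dupNamespace false

noncomputable section

namespace Summit.HodgeConjecture.HodgeConjecture.Theorems.MarkmanPartnerTransport.RealMultiplicationType

open Module CategoryTheory MonoidalCategory CartesianMonoidalCategory Polynomial
open Literature.AlgebraicGeometry Literature.AlgebraicGeometry.Motives Literature.AlgebraicGeometry.HodgeTheory
open Literature.AlgebraicGeometry.Surfaces
open Literature.AlgebraicTopology.SingularHomology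
open Summit.HodgeConjecture.HodgeConjecture.Theorems
open Summit.HodgeConjecture.HodgeConjecture.Theorems.NikulinTwinTransport

variable {S : SchemeOver ℂ}

/-- `Transc[S, y]`: `y` is cup-orthogonal to `N¹(S)`. Local notation only. -/
local notation3 (prettyPrint := false) "Transc[" S ", " y "]" =>
  (∀ d ∈ algebraicClasses S 1, cupProduct (rfl : 2 * 1 + 2 * 1 = 2 * 2) y d = 0)

/-- `Scalar[S]`: «`End_Hdg(T(S)) = ℚ`» — VERBATIM the scalar clause of `…RealMultiplicationType`. Local notation only. -/
local notation3 (prettyPrint := false) "Scalar[" S "]" =>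
  (∀ (f : complexBetti S (2 * 1) →ₗ[ℂ] complexBetti S (2 * 1)),
    (∀ y, IsRationalClass y → IsRationalClass (f y)) →
    (∀ (i j : ℕ) y, IsOfHodgeType 2 S (2 * 1) i j y → IsOfHodgeType 2 S (2 * 1) i j (f y)) →
    (∀ d ∈ algebraicClasses S 1, f d = 0) →
    (∀ y : complexBetti S (2 * 1), ∀ d ∈ algebraicClasses S 1,
      cupProduct (rfl : 2 * 1 + 2 * 1 = 2 * 2) (f y) d = 0) →
    ∃ a : ℚ, ∀ y : complexBetti S (2 * 1),
      (∀ d ∈ algebraicClasses S 1, cupProduct (rfl : 2 * 1 + 2 * 1 = 2 * 2) y d = 0) →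
        f y = (a : ℂ) • y)

/-! ### A non-zero transcendental class -/

/-- **A projective K3 surface has a non-zero transcendental class**: the `(2,0)`-class `σ = η⁻¹ x` of a marking is
non-zero and cup-orthogonal to `N¹(S)` (the classes of `N¹(S)` are of type `(1,1)`, i.e. cup-orthogonal to `σ` and
`σ̄`, `Huybrechts_K3_hodgeTypes_H2`). [cite: Huybrechts2016K3, Ch. 3 Lemma 3.3.1] -/
theorem exists_transc_ne_zero (hmark : Huybrechts_K3_marking_exists) (hS : IsK3Surface S) :
    ∃ σ : complexBetti S (2 * 1), IsOfHodgeType 2 S (2 * 1) 2 0 σ ∧ σ ≠ 0 ∧ Transc[S, σ] := by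
  have hHT : Huybrechts_K3_hodgeTypes_H2 := Huybrechts_K3_hodgeTypes_H2_holds
  obtain ⟨η, p₀, x, hp₀, ⟨-, -, -, hηcup, hx20, -⟩, -, hxpos, -⟩ := hmark S hS
  set σ := η.symm x with hσdef
  have hησ : η σ = x := by rw [hσdef, LinearEquiv.apply_symm_apply]
  have hxne : σ ≠ 0 := by
    intro h0
    have hx : x = 0 := by rw [← hησ, h0, map_zero]
    subst hx; simp [k3Form] at hxpos
  obtain ⟨-, -, h₃⟩ := hHT S hS σ hx20 hxne
  refine ⟨σ, hx20, hxne, fun d hd => ?_⟩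
  have h11 := (h₃ d).1 (isOfHodgeType_of_mem_algebraicClasses_of_isSmoothProjective hS.1 1 hd)
  rw [hηcup, k3Form_comm, ← hηcup]
  exact h11.1

/-! ### «RM-EXACT-K3» -/

/-- **An RM K3 surface is not scalar.** If `IsRealMultiplicationK3 S ρ P` with `P` irreducible of degree `≥ 2`, then
NOT every rational Hodge endomorphism of `T(S)` is a rational scalar: applied to the generator `t`, a scalar `a` with
`t = a` on `T(S)` together with `P(t) = 0` on `T(S)` and Bézout `u·P + v·(X − a) = 1` (`P ∤ (X − a)` by degree) gives
`T(S) = 0`, contradicting `exists_transc_ne_zero`. [cite: GeemenSchutt2023, §2.1] [cite: Zarhin1983HodgeGroupsK3, Thm. 1.5.1] -/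
theorem not_scalar_of_isRealMultiplicationK3 (hmark : Huybrechts_K3_marking_exists) {ρ : ℕ} {P : ℚ[X]}
    (h : IsRealMultiplicationK3 S ρ P) (hP : Irreducible P) (hd : 2 ≤ P.natDegree) : ¬ Scalar[S] := by
  intro hQ
  obtain ⟨hS, -, -, t, ht_rat, ht_typ, ht_N, ht_perp, hann, -⟩ := h
  obtain ⟨a, ha⟩ := hQ t ht_rat ht_typ ht_N ht_perp
  obtain ⟨σ, -, hσne, hσT⟩ := exists_transc_ne_zero hmark hS
  -- Bézout in `ℚ[X]`
  have hndvd : ¬ P ∣ (X - C a) := fun hdvd => by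
    have h1 := Polynomial.natDegree_le_of_dvd hdvd (X_sub_C_ne_zero a)
    rw [natDegree_X_sub_C] at h1
    omega
  obtain ⟨u, v, huv⟩ := (hP.coprime_iff_not_dvd.2 hndvd)
  -- evaluate at `t` on the transcendental class `σ`
  have hPσ : Polynomial.aeval t (P.map (algebraMap ℚ ℂ)) σ = 0 := hann σ hσT
  have hXσ : Polynomial.aeval t ((X - C a).map (algebraMap ℚ ℂ)) σ = 0 := by
    rw [Polynomial.map_sub, Polynomial.map_X, Polynomial.map_C, map_sub, Polynomial.aeval_X, Polynomial.aeval_C,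
      LinearMap.sub_apply, ha σ hσT, Module.algebraMap_end_apply, eq_ratCast, sub_self]
  have hone : Polynomial.aeval t ((u * P + v * (X - C a)).map (algebraMap ℚ ℂ)) σ = σ := by
    rw [huv, Polynomial.map_one, map_one, Module.End.one_apply]
  rw [Polynomial.map_add, Polynomial.map_mul, Polynomial.map_mul, map_add, map_mul, map_mul, LinearMap.add_apply,
    Module.End.mul_apply, Module.End.mul_apply, hPσ, hXσ, map_zero, map_zero, add_zero] at hone
  exact hσne hone.symm

/-- **«RM-EXACT-K3»: the real-multiplication third of a projective K3 surface is EXACTLY van Geemen–Schütt's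
`IsRealMultiplicationK3`.** For a projective K3 surface `S` (granted markings): `¬ HasComplexMultiplication S ∧ ¬ Scalar`
iff `S` is an RM K3 surface `IsRealMultiplicationK3 S ρ(S) P` of some type (`P` irreducible, `2 ≤ deg P`, `3 ≤ m`,
`deg P · m + ρ(S) = 22`) — «RM-GEN-K3» one way, `not_scalar_of_isRealMultiplicationK3` the other. K3-side twin of
`PartnerLattice.not_spannedByIsometries_iff_exists_rmGenerator`. [cite: GeemenSchutt2023, §2.1 and §2.4]
[cite: Vangeemen2008, Lemma 3.2] [cite: Zarhin1983HodgeGroupsK3, Thm. 1.5.1] -/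
theorem not_hasComplexMultiplication_and_not_scalar_iff (hmark : Huybrechts_K3_marking_exists) (hS : IsK3Surface S) :
    (¬ HasComplexMultiplication S ∧ ¬ Scalar[S]) ↔
      ∃ (P : ℚ[X]) (m : ℕ), Irreducible P ∧ 2 ≤ P.natDegree ∧ 3 ≤ m ∧
        P.natDegree * m + Module.finrank ℂ ↥(algebraicClasses S 1) = 22 ∧
        IsRealMultiplicationK3 S (Module.finrank ℂ ↥(algebraicClasses S 1)) P := by
  constructor
  · rintro ⟨hCM, hQ⟩
    exact exists_isRealMultiplicationK3_of_not_hasComplexMultiplication hmark hS hCM hQ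
  · rintro ⟨P, m, hP, hd, -, -, h⟩
    exact ⟨h.not_hasComplexMultiplication, not_scalar_of_isRealMultiplicationK3 hmark h hP hd⟩

/-! ### The table of real-multiplication types -/

/-- **The twenty real-multiplication types** `(ρ, d, m)` with `d · m + ρ = 22`, `d ≥ 2`, `m ≥ 3`, `ρ ≥ 1` (van
Geemen–Schütt's table: `ρ ≤ 16`, `m = dim_E T ≥ 3`). [cite: GeemenSchutt2023, §2.4 and §3.4] [cite: Vangeemen2008, Lemma 3.2] -/
theorem mem_rmTypes {ρ d m : ℕ} (h1 : 1 ≤ ρ) (hd : 2 ≤ d) (hm : 3 ≤ m) (h : d * m + ρ = 22) :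
    (ρ, d, m) ∈ ({(16, 2, 3), (14, 2, 4), (13, 3, 3), (12, 2, 5), (10, 2, 6), (10, 3, 4), (10, 4, 3), (8, 2, 7),
      (7, 3, 5), (7, 5, 3), (6, 2, 8), (6, 4, 4), (4, 2, 9), (4, 3, 6), (4, 6, 3), (2, 2, 10), (2, 4, 5), (2, 5, 4),
      (1, 3, 7), (1, 7, 3)} : Finset (ℕ × ℕ × ℕ)) := by
  have hd' : d ≤ 7 := by nlinarith
  have hm' : m ≤ 10 := by nlinarith
  obtain rfl : ρ = 22 - d * m := by omega
  interval_cases d <;> interval_cases m <;> first | decide | (exfalso; omega)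

/-- **The fifteen real-multiplication types with `ρ ≥ 3`** (the range of crux `PicardThreeK3Squares`).
[cite: GeemenSchutt2023, §2.4 and §3.4] [cite: Vangeemen2008, Lemma 3.2] -/
theorem mem_rmTypes_of_three_le {ρ d m : ℕ} (h3 : 3 ≤ ρ) (hd : 2 ≤ d) (hm : 3 ≤ m) (h : d * m + ρ = 22) :
    (ρ, d, m) ∈ ({(16, 2, 3), (14, 2, 4), (13, 3, 3), (12, 2, 5), (10, 2, 6), (10, 3, 4), (10, 4, 3), (8, 2, 7),
      (7, 3, 5), (7, 5, 3), (6, 2, 8), (6, 4, 4), (4, 2, 9), (4, 3, 6), (4, 6, 3)} : Finset (ℕ × ℕ × ℕ)) := by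
  have hd' : d ≤ 7 := by nlinarith
  have hm' : m ≤ 10 := by nlinarith
  obtain rfl : ρ = 22 - d * m := by omega
  interval_cases d <;> interval_cases m <;> first | decide | (exfalso; omega)

/-- `ρ = 13` forces the type `(13, 3, 3)`: `9 = d · m` with `d ≥ 2`, `m ≥ 3`. [cite: GeemenSchutt2023, §3.4] -/
theorem eq_three_three_of_rank_thirteen {d m : ℕ} (hd : 2 ≤ d) (hm : 3 ≤ m) (h : d * m + 13 = 22) :
    d = 3 ∧ m = 3 := by
  have hd' : d ≤ 3 := by nlinarith
  interval_cases d <;> omega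

/-- **«RungRank13» by name: at `ρ(S) = 13` real multiplication is CUBIC with `dim_E T(S) = 3`.** A non-CM, non-scalar
projective K3 surface with `ρ(S) = 13` is an RM K3 surface `IsRealMultiplicationK3 S 13 P` with `P` irreducible of degree
`3` and `3 · 3 + 13 = 22` (type `(13,3,3)`: `E` a totally real cubic field, `T(S)_ℚ ≅ E³`; one-dimensional strata —
compact Shimura curves). [cite: GeemenSchutt2023, §2.4 and §3.4] [cite: Vangeemen2008, Lemma 3.2] -/
theorem exists_isRealMultiplicationK3_cubic_of_rank_thirteen (hmark : Huybrechts_K3_marking_exists) (hS : IsK3Surface S)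
    (hCM : ¬ HasComplexMultiplication S) (hQ : ¬ Scalar[S]) (h13 : Module.finrank ℂ ↥(algebraicClasses S 1) = 13) :
    ∃ P : ℚ[X], Irreducible P ∧ P.natDegree = 3 ∧ IsRealMultiplicationK3 S 13 P := by
  obtain ⟨P, m, hPirr, hd2, hm, hsum, hRM⟩ :=
    exists_isRealMultiplicationK3_of_not_hasComplexMultiplication hmark hS hCM hQ
  rw [h13] at hsum hRM
  exact ⟨P, hPirr, (eq_three_three_of_rank_thirteen hd2 hm hsum).1, hRM⟩

/-- The possible field degrees at the Picard numbers of the crux: `ρ = 4 ⇒ d ∈ {2,3,6}`, `ρ = 6 ⇒ d ∈ {2,4}`,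
`ρ = 7 ⇒ d ∈ {3,5}`, `ρ = 10 ⇒ d ∈ {2,3,4}`, `ρ = 13 ⇒ d = 3`, `ρ ∈ {8,12,14,16} ⇒ d = 2` (read off `mem_rmTypes_of_three_le`).
[cite: GeemenSchutt2023, §3.4] -/
theorem natDegree_mem_of_rank {ρ d m : ℕ} (h3 : 3 ≤ ρ) (hd : 2 ≤ d) (hm : 3 ≤ m) (h : d * m + ρ = 22) :
    (ρ = 4 → d = 2 ∨ d = 3 ∨ d = 6) ∧ (ρ = 6 → d = 2 ∨ d = 4) ∧ (ρ = 7 → d = 3 ∨ d = 5) ∧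
      (ρ = 10 → d = 2 ∨ d = 3 ∨ d = 4) ∧ (ρ = 13 → d = 3) ∧
      (ρ = 8 ∨ ρ = 12 ∨ ρ = 14 ∨ ρ = 16 → d = 2) := by
  have hd' : d ≤ 7 := by nlinarith
  interval_cases d <;> omega

end Summit.HodgeConjecture.HodgeConjecture.Theorems.MarkmanPartnerTransport.RealMultiplicationType

end
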